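import Summits.MatrixMultiplication.OmegaCensus.DominoZ7Z7Cover6A
import HarnessLib

/-!
# Kernel covers on `ZMod 7 × ZMod 7`: part `6` (C: chunks 5–6, axis normal forms)

ω-census `pub-omega`, family (b3), seat pub-omega-group gen 20.  Framing: lottery ticket; floor = certified bounds/negative
ranges.  VALUE: the finite kernel computation behind the `ℤ_7 × ℤ_7` domino cell theorems with a part `6` (`DominoZ7Z7Cells.lean`, which assembles the chunks of files A, B, C); NOT progress on ω.

Instances of the generic margin-pruned enumeration `DominoZpZpCover.lean`: per part size `d`, the search tree of the
codes of the UNcertified 1-D multisets (`passTree…`, untrusted), its extensional soundness against the certified table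
(`…_sound`, `decide`), the kernel cover computations (`cover_…`, `decide`; normal form (i) chunked), and the assembled
semantic statement `exists_table_entry_7_6` consumed by the cell theorems.  Enumeration sizes (leaves / nodes, exact
Python twin `pub-omega-group-g20/code/emulate.py`): see part A.
-/

namespace Summit.MatrixMultiplication.OmegaCensus

namespace ZpZpDomino

set_option maxHeartbeats 4000000 in
/-- Kernel cover computation, `p = 7`, `d = 6`, normal form (i), chunk `5` of `7`. [folklore] -/
theorem cover_7_6_nf1_5 : coverNF1 7 6 passTreeZ7d6 2 7 5 = true := by decide +kernel

set_option maxHeartbeats 4000000 in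
/-- Kernel cover computation, `p = 7`, `d = 6`, normal form (i), chunk `6` of `7`. [folklore] -/
theorem cover_7_6_nf1_6 : coverNF1 7 6 passTreeZ7d6 2 7 6 = true := by decide +kernel

set_option maxHeartbeats 4000000 in
/-- Kernel cover computation, `p = 7`, `d = 6`, normal form (ii). [folklore] -/
theorem cover_7_6_nf2 : coverNF2 7 6 passTreeZ7d6 = true := by decide +kernel

/-- Kernel cover computation, `p = 7`, `d = 6`, normal form (iii). [folklore] -/
theorem cover_7_6_nf3 : coverNF3 7 6 passTreeZ7d6 = true := by decide +kernel

/-- Every entry of the part-`6` table is a valid certificate. [folklore] -/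
theorem tableZ7d6_cert : ∀ e ∈ tableZ7d6, lineCert 7 (vecFn e.1) e.2 = true := by
  intro e he
  simp only [tableZ7d6, List.mem_append] at he
  rcases he with (he | he) | he
  · exact tableZ7d6a_cert e he
  · exact tableZ7d6b_cert e he
  · exact tableZ7d6c_cert e he

end ZpZpDomino

end Summit.MatrixMultiplication.OmegaCensus
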